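import Literature.NumberTheory.QuadraticFields.ScholzHeckeUnitCriterionProofs
import Literature.NumberTheory.NumberFields.AlgClosureCubeRootsOfUnity
import Literature.NumberTheory.NumberFields.UnramifiedBaseChangePrimeDegree
import Mathlib.FieldTheory.KummerExtension
import Mathlib.GroupTheory.SpecificGroups.Cyclic.Basic
import HarnessLib

/-!
# Scholz–Hecke unit criterion, direction (ii): the Kummer tower `K ⊆ M = K(ζ₃) ⊆ N = E·M`

Topic `NumberTheory/QuadraticFields`.  Theorem-only file (no definition, no named fact), part of
the proof of `ScholzHecke_unitCubeCriterion` (`ScholzHeckeUnitCriterion.lean`), direction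
`3 ∣ h(−d) → UnitCubeAtThree d` (Washington, proof of Thm. 10.10).

For an imaginary quadratic field `K` and an unramified cyclic cubic extension `E ⊆ K̄` of `K` (a
cubic class field, which exists when `3 ∣ h_K`, tree `exists_isCubicClassField`) we set up, inside `K̄`, the tower

  `K ⊆ M = K(ζ) ⊆ N = E·K(ζ)`, `ζ` a primitive cube root of unity,

as the number field `L = ↥(E ⊔ K⟮ζ⟯)` with the intermediate field `M' = K⟮ζ'⟯`:
`[M' : K] = 2`, `[L : M'] = 3`, `L/M'` Galois (cyclic), **unramified at every prime**
(`isUnramifiedAt_sup`, base change of the unramified `E/K` by the quadratic `K(ζ)/K`: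
`UnramifiedBaseChangePrimeDegree.lean`), and a **Kummer generator**: `y ∈ L`, `σ ∈ Gal(L/M')`
with `y³ = θ ∈ M'`, `L = M'(y)`, `σ y = ζ y` (`exists_kummer_generator`, Hilbert 90 via Mathlib's
`exists_root_adjoin_eq_top_of_isCyclic`), unique up to `y ↦ yⁱ·m`
(`ScholzHeckeKummerDescent.lean`).

## References

* L. C. Washington, *Introduction to Cyclotomic Fields*, GTM 83 (2nd ed. 1997), Thm. 10.10 and
  its proof. [Washington1997]
* E. Hecke, *Lectures on the Theory of Algebraic Numbers*, GTM 77 (1981), §39. [Hecke1981]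
-/

noncomputable section

open NumberField Module IntermediateField Polynomial IsDedekindDomain

namespace Literature.NumberTheory.QuadraticFields

namespace ScholzHecke

open Literature.NumberTheory.NumberFields

/-! ### Group- and field-theoretic helpers -/

/-- In a Galois extension of prime degree `3`, the elements fixed by a non-trivial automorphism lie
in the base field. [folklore] -/
theorem mem_range_of_fixed {F L : Type*} [Field F] [Field L] [Algebra F L]
    [FiniteDimensional F L] [IsGalois F L] (h3 : finrank F L = 3) {σ : L ≃ₐ[F] L} (hσ : σ ≠ 1)
    {z : L} (hz : σ z = z) : z ∈ Set.range (algebraMap F L) := by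
  haveI : Fact (Nat.Prime 3) := ⟨Nat.prime_three⟩
  have hcard : Nat.card (L ≃ₐ[F] L) = 3 := by rw [IsGalois.card_aut_eq_finrank, h3]
  have htop : Subgroup.zpowers σ = ⊤ := zpowers_eq_top_of_prime_card hcard hσ
  have hstab : Subgroup.zpowers σ ≤ MulAction.stabilizer (L ≃ₐ[F] L) z :=
    Subgroup.zpowers_le.mpr (by rw [MulAction.mem_stabilizer_iff]; exact hz)
  have hmem : z ∈ IntermediateField.fixedField (⊤ : Subgroup (L ≃ₐ[F] L)) := by
    rw [← htop]
    intro g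
    exact hstab g.2
  rwa [IsGalois.fixedField_top, IntermediateField.mem_bot] at hmem

/-- **Kummer generator of a cyclic cubic extension with an eigen-automorphism.**  Let `L/F` be
Galois of degree `3` and `ζ ∈ F` a primitive cube root of unity.  Then there are `y ∈ L` and
`σ ∈ Gal(L/F)`, `σ ≠ 1`, with `y ≠ 0`, `y³ ∈ F`, `y ∉ F`, `L = F(y)` and `σ y = ζ y`
(Kummer theory / Hilbert 90, Mathlib `exists_root_adjoin_eq_top_of_isCyclic`). [folklore] -/
theorem exists_kummer_generator {F L : Type*} [Field F] [Field L] [Algebra F L]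
    [FiniteDimensional F L] [IsGalois F L] (h3 : finrank F L = 3) {ζ : F}
    (hζ : IsPrimitiveRoot ζ 3) :
    ∃ (y : L) (σ : L ≃ₐ[F] L), σ ≠ 1 ∧ y ≠ 0 ∧ y ^ 3 ∈ Set.range (algebraMap F L) ∧
      y ∉ Set.range (algebraMap F L) ∧ F⟮y⟯ = ⊤ ∧ σ y = algebraMap F L ζ * y := by
  classical
  haveI : Fact (Nat.Prime 3) := ⟨Nat.prime_three⟩
  have hcard : Nat.card (L ≃ₐ[F] L) = 3 := by rw [IsGalois.card_aut_eq_finrank, h3]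
  haveI : IsCyclic (L ≃ₐ[F] L) := isCyclic_of_prime_card hcard
  have hK : (primitiveRoots (finrank F L) F).Nonempty :=
    ⟨ζ, by rw [h3, mem_primitiveRoots (by norm_num : 0 < 3)]; exact hζ⟩
  obtain ⟨y, hy3, hytop⟩ := exists_root_adjoin_eq_top_of_isCyclic F L hK
  rw [h3] at hy3
  have hyF : y ∉ Set.range (algebraMap F L) := by
    rintro ⟨c, hc⟩
    have hle : F⟮y⟯ ≤ ⊥ := by
      rw [IntermediateField.adjoin_simple_le_iff, ← hc]; exact IntermediateField.algebraMap_mem _ c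
    rw [hytop, top_le_iff] at hle
    have := congrArg (fun E : IntermediateField F L => finrank F E) hle
    simp only [IntermediateField.finrank_bot, IntermediateField.finrank_top', h3] at this
    omega
  have hy0 : y ≠ 0 := by
    rintro rfl
    exact hyF ⟨0, map_zero _⟩
  haveI : Nontrivial (L ≃ₐ[F] L) := Finite.one_lt_card_iff_nontrivial.mp (by rw [hcard]; norm_num)
  obtain ⟨σ₀, hσ₀⟩ := exists_ne (1 : L ≃ₐ[F] L)
  obtain ⟨t, ht⟩ := hy3
  have hζL : IsPrimitiveRoot (algebraMap F L ζ) 3 := hζ.map_of_injective (algebraMap F L).injective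
  have hω3 : (σ₀ y / y) ^ 3 = 1 := by
    rw [div_pow, ← map_pow, ← ht, AlgEquiv.commutes, div_self]
    rw [ht]; exact pow_ne_zero 3 hy0
  obtain ⟨i, hi, hω⟩ := hζL.eq_pow_of_pow_eq_one hω3
  rw [eq_comm, div_eq_iff hy0] at hω
  interval_cases i
  · rw [pow_zero, one_mul] at hω
    exact absurd (mem_range_of_fixed h3 hσ₀ hω) hyF
  · exact ⟨y, σ₀, hσ₀, hy0, ⟨t, ht⟩, hyF, hytop, by rw [hω, pow_one]⟩
  · refine ⟨y, σ₀ ^ 2, ?_, hy0, ⟨t, ht⟩, hyF, hytop, ?_⟩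
    · intro h
      have h1 : orderOf σ₀ ∣ 2 := orderOf_dvd_of_pow_eq_one h
      have h2 : orderOf σ₀ ∣ 3 := hcard ▸ orderOf_dvd_natCard σ₀
      have : orderOf σ₀ ∣ Nat.gcd 2 3 := Nat.dvd_gcd h1 h2
      rw [show Nat.gcd 2 3 = 1 by norm_num, Nat.dvd_one, orderOf_eq_one_iff] at this
      exact hσ₀ this
    · have hζ3 : (algebraMap F L ζ) ^ 3 = 1 := hζL.pow_eq_one
      rw [pow_two, AlgEquiv.mul_apply, hω, map_mul, map_pow, AlgEquiv.commutes, hω]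
      linear_combination (algebraMap F L ζ) * y * hζ3

/-! ### Cube roots of unity in `K̄` -/

variable {K : Type} [Field K]

/-- `K̄` contains a primitive cube root of unity (characteristic `0`). [folklore] -/
theorem exists_isPrimitiveRoot_three [CharZero K] : ∃ ζ : AlgebraicClosure K, IsPrimitiveRoot ζ 3 :=
  HasEnoughRootsOfUnity.exists_primitiveRoot (AlgebraicClosure K) 3

/-- `λ = 2ζ + 1` satisfies `λ² = −3`. [folklore] -/
theorem sq_two_mul_zeta_add_one {L : Type*} [CommRing L] [IsDomain L] {ζ : L}
    (hζ : IsPrimitiveRoot ζ 3) : (2 * ζ + 1) ^ 2 = -3 := by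
  have h := hζ.geom_sum_eq_zero (by norm_num : 1 < 3)
  simp only [Finset.sum_range_succ, Finset.sum_range_zero, pow_zero, pow_one, zero_add] at h
  linear_combination 4 * h

/-- For `K = ℚ(√−d)`, `−d` fundamental, `d ≠ 3`: `ζ ∉ K`. [folklore] -/
theorem zeta_not_mem_range [CharZero K] (h2 : finrank ℚ K = 2) {δ : K}
    (hδ : δ ∉ Set.range (algebraMap ℚ K)) {d : ℕ} (hδ2 : δ ^ 2 = -(d : K))
    (hd : ((-(d:ℤ)) % 4 = 1 ∧ Squarefree (-(d:ℤ)) ∧ (-(d:ℤ)) ≠ 1) ∨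
      (4 ∣ (-(d:ℤ)) ∧ ((-(d:ℤ)) / 4 % 4 = 2 ∨ (-(d:ℤ)) / 4 % 4 = 3) ∧ Squarefree ((-(d:ℤ)) / 4)))
    (h3 : d ≠ 3) {L : Type*} [Field L] [Algebra K L] {ζ : L} (hζ : IsPrimitiveRoot ζ 3) :
    ζ ∉ Set.range (algebraMap K L) := by
  rintro ⟨x, hx⟩
  apply algebraMap_ne_lam h2 hδ hδ2 hd h3 (sq_two_mul_zeta_add_one hζ) (2 * x + 1)
  rw [map_add, map_mul, map_ofNat, map_one, hx]

/-! ### The tower `K ⊆ M' = K(ζ') ⊆ L = E·K(ζ)` inside `K̄` -/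

section Tower

variable (E : IntermediateField K (AlgebraicClosure K)) {ζ : AlgebraicClosure K}

/-- `ζ ∈ E·K(ζ)`. [folklore] -/
theorem zeta_mem_sup : ζ ∈ E ⊔ K⟮ζ⟯ :=
  (le_sup_right : K⟮ζ⟯ ≤ E ⊔ K⟮ζ⟯) (mem_adjoin_simple_self K ζ)

/-- `E ⊆ E·K(ζ)`. [folklore] -/
theorem mem_sup_of_mem {x : AlgebraicClosure K} (hx : x ∈ E) : x ∈ E ⊔ K⟮ζ⟯ :=
  (le_sup_left : E ≤ E ⊔ K⟮ζ⟯) hx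

/-- `[K(ζ') : K] = 2` for the internal `ζ' ∈ L = E·K(ζ)`. [folklore] -/
theorem finrank_adjoin_zeta_internal (hζ : IsPrimitiveRoot ζ 3)
    (hζK : ζ ∉ Set.range (algebraMap K (AlgebraicClosure K))) :
    finrank K K⟮(⟨ζ, zeta_mem_sup E⟩ : ↥(E ⊔ K⟮ζ⟯))⟯ = 2 := by
  have hint : IsIntegral K (⟨ζ, zeta_mem_sup E⟩ : ↥(E ⊔ K⟮ζ⟯)) :=
    IntermediateField.isIntegral_iff.mpr (Algebra.IsIntegral.isIntegral ζ)
  rw [adjoin.finrank hint, IntermediateField.minpoly_eq]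
  show (minpoly K ζ).natDegree = 2
  rw [minpoly_eq hζ hζK]
  compute_degree!

/-- `L = E·K(ζ)` is finite over `K`. [folklore] -/
theorem finiteDimensional_sup [FiniteDimensional K E] (ζ : AlgebraicClosure K) :
    FiniteDimensional K ↥(E ⊔ K⟮ζ⟯) := by
  haveI := finiteDimensional_adjoin (K := K) ζ
  infer_instance

/-- `[L : K] = 6`. [folklore] -/
theorem finrank_sup [FiniteDimensional K E] (hζ : IsPrimitiveRoot ζ 3)
    (hζK : ζ ∉ Set.range (algebraMap K (AlgebraicClosure K))) (hE3 : finrank K E = 3) :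
    finrank K ↥(E ⊔ K⟮ζ⟯) = 6 :=
  finrank_sup_adjoin_eq hζ hζK E hE3

/-- `L/K` is Galois (compositum of Galois extensions). [folklore] -/
theorem isGalois_sup [IsGalois K E] (hζ : IsPrimitiveRoot ζ 3) : IsGalois K ↥(E ⊔ K⟮ζ⟯) := by
  haveI := isGalois_adjoin (K := K) hζ
  haveI : Normal K ↥(E ⊔ K⟮ζ⟯) := IntermediateField.normal_sup K (AlgebraicClosure K) E K⟮ζ⟯
  exact ⟨⟩

/-- `[L : K(ζ')] = 3`. [folklore] -/
theorem finrank_sup_adjoin_zeta [FiniteDimensional K E] (hζ : IsPrimitiveRoot ζ 3)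
    (hζK : ζ ∉ Set.range (algebraMap K (AlgebraicClosure K))) (hE3 : finrank K E = 3) :
    finrank K⟮(⟨ζ, zeta_mem_sup E⟩ : ↥(E ⊔ K⟮ζ⟯))⟯ ↥(E ⊔ K⟮ζ⟯) = 3 := by
  haveI := finiteDimensional_sup E ζ
  have h := finrank_mul_finrank K K⟮(⟨ζ, zeta_mem_sup E⟩ : ↥(E ⊔ K⟮ζ⟯))⟯ ↥(E ⊔ K⟮ζ⟯)
  rw [finrank_adjoin_zeta_internal E hζ hζK, finrank_sup E hζ hζK hE3] at h
  omega

/-- `[L : E] = 2` (for the inclusion `E ⊆ L`). [folklore] -/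
theorem finrank_sup_left [FiniteDimensional K E] (hζ : IsPrimitiveRoot ζ 3)
    (hζK : ζ ∉ Set.range (algebraMap K (AlgebraicClosure K))) (hE3 : finrank K E = 3) :
    letI : Algebra E ↥(E ⊔ K⟮ζ⟯) := (IntermediateField.inclusion le_sup_left).toRingHom.toAlgebra
    finrank E ↥(E ⊔ K⟮ζ⟯) = 2 := by
  letI : Algebra E ↥(E ⊔ K⟮ζ⟯) := (IntermediateField.inclusion le_sup_left).toRingHom.toAlgebra
  haveI : IsScalarTower K E ↥(E ⊔ K⟮ζ⟯) := IsScalarTower.of_algebraMap_eq fun x => rfl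
  haveI := finiteDimensional_sup E ζ
  have h := finrank_mul_finrank K E ↥(E ⊔ K⟮ζ⟯)
  rw [hE3, finrank_sup E hζ hζK hE3] at h
  omega

/-- **`L/K(ζ')` is unramified at every prime** when `E/K` is (base change of the unramified cubic
`E/K` by the quadratic `K(ζ)/K`). [cite: Washington1997, Thm 10.10 (proof)] -/
theorem isUnramifiedAt_sup [NumberField K] [FiniteDimensional K E] [IsGalois K E]
    (hζ : IsPrimitiveRoot ζ 3) (hζK : ζ ∉ Set.range (algebraMap K (AlgebraicClosure K)))
    (hE3 : finrank K E = 3)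
    (hEunr : ∀ v : HeightOneSpectrum (𝓞 K), Algebra.IsUnramifiedIn (𝓞 E) v.asIdeal)
    (𝔔 : Ideal (𝓞 ↥(E ⊔ K⟮ζ⟯))) [𝔔.IsMaximal] :
    Algebra.IsUnramifiedAt (𝓞 K⟮(⟨ζ, zeta_mem_sup E⟩ : ↥(E ⊔ K⟮ζ⟯))⟯) 𝔔 := by
  haveI := finiteDimensional_sup E ζ
  haveI := isGalois_sup E hζ
  haveI : NumberField ↥(E ⊔ K⟮ζ⟯) := NumberField.of_module_finite K _
  haveI : NumberField E := NumberField.of_module_finite K _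
  letI : Algebra E ↥(E ⊔ K⟮ζ⟯) := (IntermediateField.inclusion le_sup_left).toRingHom.toAlgebra
  haveI : IsScalarTower K E ↥(E ⊔ K⟮ζ⟯) := IsScalarTower.of_algebraMap_eq fun x => rfl
  set M' := K⟮(⟨ζ, zeta_mem_sup E⟩ : ↥(E ⊔ K⟮ζ⟯))⟯
  haveI : NumberField M' := NumberField.of_module_finite K _
  refine isUnramifiedAt_of_prime_finrank_of_isUnramifiedAt_base (F := K) (E := E) (M := M')
    (N := ↥(E ⊔ K⟮ζ⟯)) Nat.prime_three (finrank_sup_adjoin_zeta E hζ hζK hE3)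
    (by rw [finrank_sup_left E hζ hζK hE3]; norm_num) (fun 𝔮 h𝔮 => ?_) 𝔔
  haveI := h𝔮
  by_cases h0 : 𝔮.under (𝓞 K) = ⊥
  · have : 𝔮 = ⊥ := Ideal.eq_bot_of_comap_eq_bot h0
    exact absurd this (Ring.ne_bot_of_isMaximal_of_not_isField h𝔮 (RingOfIntegers.not_isField E))
  · haveI hmax : (𝔮.under (𝓞 K)).IsMaximal := Ideal.IsMaximal.under (𝓞 K) 𝔮
    have hv := hEunr ⟨𝔮.under (𝓞 K), hmax.isPrime, h0⟩
    exact hv 𝔮 inferInstance ⟨rfl⟩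

end Tower

end ScholzHecke

end Literature.NumberTheory.QuadraticFields

end
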